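import Mathlib.Topology.Algebra.Category.ProfiniteGrp.Basic
import Mathlib.Topology.Algebra.Group.Quotient
import Mathlib.Topology.Algebra.ClopenNhdofOne
import Literature.AnabelianGeometry.SemiGraphs.CharacteristicOpenCore
import Literature.AnabelianGeometry.SemiGraphs.OuterSemidirectProductTopology
import HarnessLib

/-!
# The automorphism group of a topologically finitely generated profinite group is profinite ([SemiAnbd] §0 p. 5)

Mochizuki, *Semi-graphs of anabelioids*, Publ. RIMS **42** (2006), §0 "Topological Groups" p. 5
[cite: MochizukiSemiAnbd2006, §0 p.5]: `Aut(G)`, `Out(G)` and `G ⋊^out J` are used as TOPOLOGICAL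
groups throughout [SemiAnbd] §5, [CombGC] and [AbsTopII] §1 (e.g. [AbsTopII] Def 1.2 (ii):
`Π_H := Π_𝔾 ⋊^out H` for `H ⊆ Out(Π_𝔾)`), which rests on the classical fact (e.g. Dixon–du
Sautoy–Mann–Segal, *Analytic pro-p groups*, Prop. 1.6 / §5.1; Ribes–Zalesskii 4.4): for a
TOPOLOGICALLY FINITELY GENERATED profinite group `G` the group of bi-continuous automorphisms
`Aut(G)` is again profinite, namely `Aut(G) = lim_n Aut(G)/A_n` with
`A_n := {φ | φ ≡ id (mod V_n)}` the (finite-index) subgroup of automorphisms trivial on `G/V_n`,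
`V_n` the characteristic open core of level `n` (abc-iut-w4-d053's `SemiGraphs.charOpenCore`,
the intersection of all open subgroups of index `≤ n`).

CONSTRUCTION + PROOFS (abc-iut cell, GAP row «G-P13-GR», file F2 of abc-iut-w5-d151 g4; no instance is
declared, all carriers are Mathlib's):

* `autLevelHom G n : contMulAut G →* Equiv.Perm (G ⧸ charOpenCore G n)` — the action on the finite
  coset space — and its kernel `autLevelKer G n` = the automorphisms congruent to the identity modulo
  `charOpenCore G n` (`mem_autLevelKer_iff`); antitone in `n`, of finite index, with trivial
  intersection (profinite topologically finitely generated `G`);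
* `autLevelDiagram hG : ℕᵒᵖ ⥤ ProfiniteGrp` (the finite quotients `contMulAut G ⧸ autLevelKer G n`)
  and **`profiniteAut hG : ProfiniteGrp := ProfiniteGrp.limit (autLevelDiagram hG)`**;
* `toProfiniteAut hG : contMulAut G →* profiniteAut hG`, INJECTIVE because `⋂ V_n = 1`
  (`toProfiniteAut_injective`).  Surjectivity (gluing compatible families, compactness of `G`), the
  isomorphism `profiniteAutEquiv : contMulAut G ≃* profiniteAut hG` and the continuous inner-automorphism
  map `G →ₜ* profiniteAut hG` with closed normal range are in the sequel `ProfiniteAutGroupGlue.lean`.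

Nothing here bears on [IUTchIII] Cor. 3.12.
-/

namespace Literature.AnabelianGeometry.AbsoluteAnabelian

open Literature.AnabelianGeometry.EtaleTheta Literature.AnabelianGeometry.SemiGraphs
open Filter Topology CategoryTheory
open scoped Pointwise

universe u

section Levels

variable (G : Type u) [Group G] [TopologicalSpace G]

/-! ### The action of `Aut(G)` on the finite coset spaces `G / V_n` -/

/-- A bi-continuous automorphism `φ` permutes the left cosets of the characteristic open core `V_n`
(`φ(V_n) = V_n`). [cite: MochizukiSemiAnbd2006, §0 p.5] -/
def autLevelPerm (n : ℕ) (φ : contMulAut G) : Equiv.Perm (G ⧸ charOpenCore G n) :=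
  Quotient.congr (φ.1 : G ≃ G) fun a b => by
    rw [QuotientGroup.leftRel_apply, QuotientGroup.leftRel_apply]
    constructor
    · intro h
      have := apply_mem_charOpenCore (φ.1 : MulAut G) φ.2.1 φ.2.2 h
      simpa using this
    · intro h
      have := apply_mem_charOpenCore ((φ.1 : MulAut G)⁻¹) φ.2.2 φ.2.1 h
      simpa [map_mul, map_inv] using this

/-- `autLevelPerm` on cosets. [cite: MochizukiSemiAnbd2006, §0 p.5] -/
@[simp] theorem autLevelPerm_mk (n : ℕ) (φ : contMulAut G) (g : G) :
    autLevelPerm G n φ (QuotientGroup.mk g) = QuotientGroup.mk ((φ.1 : MulAut G) g) := rfl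

/-- **The level action `Aut(G) → 𝔖(G / V_n)`.** [cite: MochizukiSemiAnbd2006, §0 p.5] -/
def autLevelHom (n : ℕ) : contMulAut G →* Equiv.Perm (G ⧸ charOpenCore G n) where
  toFun := autLevelPerm G n
  map_one' := by
    ext q
    induction q using QuotientGroup.induction_on with
    | H g => rfl
  map_mul' _ _ := by
    ext q
    induction q using QuotientGroup.induction_on with
    | H g => rfl

/-- **The level kernel `A_n ≤ Aut(G)`**: the bi-continuous automorphisms acting trivially on `G / V_n`.
(A kernel, hence normal — no instance needed.) [cite: MochizukiSemiAnbd2006, §0 p.5] -/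
abbrev autLevelKer (n : ℕ) : Subgroup (contMulAut G) := (autLevelHom G n).ker

variable {G}

/-- `φ ∈ A_n` iff `φ ≡ id (mod V_n)`: `g⁻¹ φ(g) ∈ V_n` for every `g`. [cite: MochizukiSemiAnbd2006, §0 p.5] -/
theorem mem_autLevelKer_iff {n : ℕ} {φ : contMulAut G} :
    φ ∈ autLevelKer G n ↔ ∀ g : G, g⁻¹ * (φ.1 : MulAut G) g ∈ charOpenCore G n := by
  rw [MonoidHom.mem_ker]
  constructor
  · intro h g
    have hg := Equiv.congr_fun h (QuotientGroup.mk g)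
    rw [Equiv.Perm.one_apply] at hg
    change QuotientGroup.mk ((φ.1 : MulAut G) g) = QuotientGroup.mk g at hg
    rw [QuotientGroup.eq] at hg
    simpa using charOpenCore G n |>.inv_mem hg
  · intro h
    ext q
    induction q using QuotientGroup.induction_on with
    | H g =>
      rw [Equiv.Perm.one_apply]
      change QuotientGroup.mk ((φ.1 : MulAut G) g) = QuotientGroup.mk g
      rw [QuotientGroup.eq]
      simpa using (charOpenCore G n).inv_mem (h g)

/-- The level kernels are antitone in the level. [cite: MochizukiSemiAnbd2006, §0 p.5] -/
theorem autLevelKer_anti {n m : ℕ} (h : n ≤ m) : autLevelKer G m ≤ autLevelKer G n := fun _ hφ =>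
  mem_autLevelKer_iff.mpr fun g => charOpenCore_anti h (mem_autLevelKer_iff.mp hφ g)

/-- An automorphism congruent to the identity modulo `V_n` maps `g·V_n` into itself.
[cite: MochizukiSemiAnbd2006, §0 p.5] -/
theorem apply_mem_mul_charOpenCore {n : ℕ} {φ : contMulAut G} (hφ : φ ∈ autLevelKer G n) (g : G) :
    ∃ v ∈ charOpenCore G n, (φ.1 : MulAut G) g = g * v :=
  ⟨g⁻¹ * (φ.1 : MulAut G) g, mem_autLevelKer_iff.mp hφ g, by group⟩

end Levels

/-! ### Profinite, topologically finitely generated `G`: the levels are a basis, the kernels have finite index -/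

section Profinite

variable {G : Type u} [Group G] [TopologicalSpace G] [IsTopologicalGroup G] [CompactSpace G]
  [TotallyDisconnectedSpace G] (hG : IsTopologicallyFinitelyGenerated G)

/-- **The characteristic open cores form a neighbourhood basis of `1`** in a profinite group: every
neighbourhood of `1` contains an open normal subgroup (profiniteness), which has finite index
(compactness) and hence contains the core of its own index.
[cite: MochizukiSemiAnbd2006, §0 p.5] -/
theorem exists_charOpenCore_subset {U : Set G} (hU : U ∈ 𝓝 (1 : G)) :
    ∃ n, (charOpenCore G n : Set G) ⊆ U := by
  obtain ⟨W, hWU, hWo, h1W⟩ := mem_nhds_iff.mp hU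
  obtain ⟨H, hH⟩ := ProfiniteGrp.exist_openNormalSubgroup_sub_open_nhds_of_one hWo h1W
  haveI : DiscreteTopology (G ⧸ H.toSubgroup) := QuotientGroup.discreteTopology H.isOpen
  haveI : Finite (G ⧸ H.toSubgroup) := finite_of_compact_of_discrete
  haveI : H.toSubgroup.FiniteIndex := Subgroup.finiteIndex_of_finite_quotient
  refine ⟨H.toSubgroup.index, fun x hx => hWU (hH ?_)⟩
  exact charOpenCore_le_of_finiteIndex H.toSubgroup H.isOpen hx

/-- The characteristic open cores meet in `1`. [cite: MochizukiSemiAnbd2006, §0 p.5] -/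
theorem eq_one_of_forall_mem_charOpenCore {g : G} (hg : ∀ n, g ∈ charOpenCore G n) : g = 1 := by
  by_contra hne
  obtain ⟨n, hn⟩ := exists_charOpenCore_subset (G := G) (compl_singleton_mem_nhds (Ne.symm hne))
  exact hn (hg n) rfl

/-- **The level kernels meet in `1`**: an automorphism congruent to the identity modulo every `V_n` is
the identity. [cite: MochizukiSemiAnbd2006, §0 p.5] -/
theorem eq_one_of_forall_mem_autLevelKer {φ : contMulAut G} (hφ : ∀ n, φ ∈ autLevelKer G n) :
    φ = 1 := by
  apply Subtype.ext
  ext g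
  have h : g⁻¹ * (φ.1 : MulAut G) g = 1 :=
    eq_one_of_forall_mem_charOpenCore fun n => mem_autLevelKer_iff.mp (hφ n) g
  rw [mul_eq_one_iff_eq_inv] at h
  have h' : (φ.1 : MulAut G) g = g := (inv_injective h).symm
  simpa using h'

omit [TotallyDisconnectedSpace G] in
include hG in
/-- The coset spaces `G / V_n` are finite. [cite: MochizukiSemiAnbd2006, §0 p.5] -/
theorem finite_quotient_charOpenCore (n : ℕ) : Finite (G ⧸ charOpenCore G n) := by
  haveI : DiscreteTopology (G ⧸ charOpenCore G n) :=
    QuotientGroup.discreteTopology (isOpen_charOpenCore_of_tfg hG n)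
  exact finite_of_compact_of_discrete

omit [TotallyDisconnectedSpace G] in
include hG in
/-- **The level kernels have finite index**: `Aut(G)/A_n` embeds in the finite group `𝔖(G/V_n)`.
[cite: MochizukiSemiAnbd2006, §0 p.5] -/
theorem finite_quotient_autLevelKer (n : ℕ) : Finite (contMulAut G ⧸ autLevelKer G n) := by
  haveI := finite_quotient_charOpenCore hG n
  exact Finite.of_injective _ (QuotientGroup.kerLift_injective (autLevelHom G n))

end Profinite

/-! ### The inverse system of the finite quotients `Aut(G)/A_n` and its profinite limit -/

section Limit

variable {G : Type u} [Group G] [TopologicalSpace G]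

/-- The transition map `Aut(G)/A_m → Aut(G)/A_n` for `n ≤ m`. [cite: MochizukiSemiAnbd2006, §0 p.5] -/
def autLevelTrans {n m : ℕ} (h : n ≤ m) :
    contMulAut G ⧸ autLevelKer G m →* contMulAut G ⧸ autLevelKer G n :=
  QuotientGroup.map _ _ (MonoidHom.id _) fun _ hφ => autLevelKer_anti h hφ

/-- The transition maps on representatives. [cite: MochizukiSemiAnbd2006, §0 p.5] -/
@[simp] theorem autLevelTrans_mk {n m : ℕ} (h : n ≤ m) (φ : contMulAut G) :
    autLevelTrans h (QuotientGroup.mk φ : contMulAut G ⧸ autLevelKer G m) = QuotientGroup.mk φ := rfl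

/-- **The compatible families in `∏_n Aut(G)/A_n`** — the carrier of `lim_n Aut(G)/A_n` — as a subgroup
of the product of the (abstract) finite quotient groups. [cite: MochizukiSemiAnbd2006, §0 p.5] -/
def autLimitSubgroup : Subgroup (∀ n : ℕ, contMulAut G ⧸ autLevelKer G n) where
  carrier := {x | ∀ (n m : ℕ) (h : n ≤ m), autLevelTrans (G := G) h (x m) = x n}
  one_mem' := by intro n m h; exact map_one _
  mul_mem' {x y} hx hy := by
    intro n m h
    rw [Pi.mul_apply, Pi.mul_apply, map_mul, hx n m h, hy n m h]
  inv_mem' {x} hx := by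
    intro n m h
    rw [Pi.inv_apply, Pi.inv_apply, map_inv, hx n m h]

/-- Membership in the limit subgroup. [cite: MochizukiSemiAnbd2006, §0 p.5] -/
theorem mem_autLimitSubgroup_iff {x : ∀ n : ℕ, contMulAut G ⧸ autLevelKer G n} :
    x ∈ autLimitSubgroup (G := G) ↔ ∀ (n m : ℕ) (h : n ≤ m), autLevelTrans (G := G) h (x m) = x n :=
  Iff.rfl

variable [IsTopologicalGroup G] [CompactSpace G] (hG : IsTopologicallyFinitelyGenerated G)

/-- **`Aut(G)` as a profinite group**: `lim_n Aut(G)/A_n`, the subgroup of compatible families in the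
product of the finite DISCRETE groups `Aut(G)/A_n`, which is closed (equations between finitely many
discrete coordinates), hence compact, Hausdorff and totally disconnected.  The topology is introduced
HERE ONLY (product of discrete topologies, restricted), inside the `ProfiniteGrp` term — no instance is
declared on `contMulAut G` or its quotients. [cite: MochizukiSemiAnbd2006, §0 p.5] -/
noncomputable def profiniteAut : ProfiniteGrp.{u} :=
  letI τ : ∀ n : ℕ, TopologicalSpace (contMulAut G ⧸ autLevelKer G n) := fun _ => ⊥
  haveI hd : ∀ n : ℕ, DiscreteTopology (contMulAut G ⧸ autLevelKer G n) := fun _ => ⟨rfl⟩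
  haveI hf : ∀ n : ℕ, Finite (contMulAut G ⧸ autLevelKer G n) := finite_quotient_autLevelKer hG
  haveI : ∀ n : ℕ, IsTopologicalGroup (contMulAut G ⧸ autLevelKer G n) := fun _ => {}
  haveI : ∀ n : ℕ, CompactSpace (contMulAut G ⧸ autLevelKer G n) := fun _ => Finite.compactSpace
  have hclosed : IsClosed (autLimitSubgroup (G := G) : Set (∀ n : ℕ, contMulAut G ⧸ autLevelKer G n)) := by
    have h : (autLimitSubgroup (G := G) : Set (∀ n : ℕ, contMulAut G ⧸ autLevelKer G n)) =
        ⋂ (n : ℕ) (m : ℕ) (h : n ≤ m), {x | autLevelTrans (G := G) h (x m) = x n} := by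
      ext x
      simp only [Set.mem_iInter, Set.mem_setOf_eq]
      rfl
    rw [h]
    refine isClosed_iInter fun n => isClosed_iInter fun m => isClosed_iInter fun hnm => ?_
    exact isClosed_eq ((continuous_of_discreteTopology (f := autLevelTrans (G := G) hnm)).comp
      (continuous_apply m)) (continuous_apply n)
  haveI : CompactSpace (autLimitSubgroup (G := G)) := isCompact_iff_compactSpace.mp hclosed.isCompact
  ProfiniteGrp.of (autLimitSubgroup (G := G))

/-- The carrier of `profiniteAut hG` is the limit subgroup (definitional). [cite: MochizukiSemiAnbd2006, §0 p.5] -/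
theorem coe_profiniteAut : (profiniteAut hG : Type u) = autLimitSubgroup (G := G) := rfl

/-- The canonical homomorphism `Aut(G) → lim_n Aut(G)/A_n`. [cite: MochizukiSemiAnbd2006, §0 p.5] -/
noncomputable def toProfiniteAut : contMulAut G →* profiniteAut hG where
  toFun φ := ⟨fun n => (QuotientGroup.mk φ : contMulAut G ⧸ autLevelKer G n), fun _ _ _ => rfl⟩
  map_one' := rfl
  map_mul' _ _ := rfl

/-- Components of `toProfiniteAut`. [cite: MochizukiSemiAnbd2006, §0 p.5] -/
@[simp] theorem toProfiniteAut_apply (φ : contMulAut G) (n : ℕ) :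
    (toProfiniteAut hG φ).1 n = (QuotientGroup.mk φ : contMulAut G ⧸ autLevelKer G n) := rfl

variable [TotallyDisconnectedSpace G]

/-- **`Aut(G) → lim_n Aut(G)/A_n` is injective** (`⋂ A_n = 1`). [cite: MochizukiSemiAnbd2006, §0 p.5] -/
theorem toProfiniteAut_injective : Function.Injective (toProfiniteAut hG) := by
  refine (injective_iff_map_eq_one _).mpr fun φ hφ => eq_one_of_forall_mem_autLevelKer fun n => ?_
  have h := congrArg (fun x : profiniteAut hG => (x.1 n : contMulAut G ⧸ autLevelKer G n)) hφ
  simp only [toProfiniteAut_apply] at h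
  exact (QuotientGroup.eq_one_iff φ).mp h

end Limit

end Literature.AnabelianGeometry.AbsoluteAnabelian
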